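import Literature.AnabelianGeometry.SemiGraphs.PSCSmoothProperShape
import Literature.AnabelianGeometry.SemiGraphs.PSCSmoothProperGenuineOrigin
import Literature.AnabelianGeometry.SemiGraphs.PSCGraphicitySub
import HarnessLib

/-!
# [CombGC] Rmk. 1.1.3 / 1.3.1 rank statements (`RankStatementsHold`, F-3098) at the smooth-proper shape

Mochizuki, *A combinatorial version of the Grothendieck conjecture* [CombGC], Tohoku Math. J. **59**
(2007), §1: Remark 1.1.3 p. 8 ("`Π^grph_G` is a free pro-`Σ` group of rank `n(G) − i(G) + 1`") and
Remark 1.3.1 p. 10 (the ranks of `M^edge/M^cusp`, `M/M^vert`, `M^cusp`; "`G` is noncuspidal if and only if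
`M^cusp_{G'} = 0` for every finite étale covering `G' → G`"), typed by abc-iut-w4-d052 as the level-wise
predicates `AbelianizedGrphRank`, `DualityRankEq`, `CuspRank`, `NoncuspidalIffCuspFilTrivial` and the
origin-level `RankStatementsHold Ω` (`PSCGraphicitySub.lean`, FACT-LIST F-3094 / F-3098).
[cite: MochizukiCombGC2007, Rmk 1.1.3 p.8] [cite: MochizukiCombGC2007, Rmk 1.3.1 p.10]

PROOF-ONLY file (abc-iut cell, layer L3, [CombGC] non-vacuity programme; seat abc-iut-w5-d183 gen 4, row
«T16-INPUTS-NV@SP-GENUINE», first brick).  At data of SMOOTH-PROPER SHAPE — one vertex with `Π_v = Π`, no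
nodes, no cusps (what Def. 1.1 extracts from a smooth proper curve) — every covering level `U` has
`i(G_U) = 1`, `n(G_U) = r(G_U) = 0`, `M^vert_{G_U} = M_{G_U}` and `M^edge_{G_U} = M^cusp_{G_U} = 0`, so all
four rank statements hold with every rank equal to `0`:

* `isProSigmaCompletion_of_subsingleton` — the rank-`0` case of the tree's "free of rank `r` over `Ẑ^Σ`"
  (`IsProSigmaCompletion Σ (ι : ℤ^0 → 1)`): a homomorphism between TRIVIAL groups is a pro-`Σ` completion
  for every `Σ` (complementing abc-iut-w5-d095's `not_isProSigmaCompletion_of_subsingleton`, which needs a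
  proper `Σ`-index normal subgroup of the source);
* `abelianizedGrphRank_of_smoothProper`, `dualityRankEq_of_smoothProper`, `cuspRank_of_isEmpty`,
  `noncuspidalIffCuspFilTrivial_of_isEmpty` — the four statements at the shape;
* **`rankStatementsHold_of_smoothProper`** — `RankStatementsHold Ω` for every origin `Ω` all of whose data
  have smooth-proper shape (the hypothesis shape of abc-iut-L3-t4's `…Holds_of_smoothProper` family).

Consistency / non-vacuity evidence for the typed schema at the simplest geometric shape, not the printed
statements for all pointed stable curves; a FACT row is an assumption label; nothing here takes a side on
[IUTchIII] Cor. 3.12.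
-/

noncomputable section

namespace Literature.AnabelianGeometry.SemiGraphs

open SemiGraphOfAnabelioids (IsProSigmaCompletion)
open Literature.AnabelianGeometry.Anabelioids (IsSigmaInteger)

universe u

/-! ### The rank-`0` pro-`Σ` completion -/

/-- **A homomorphism between trivial groups is a pro-`Σ` completion** (the rank-`0` case of "free of
rank `r` over `Ẑ^Σ` = pro-`Σ` completion of `ℤ^r`"): dense image trivially, every (open normal) subgroup
has index `1`, a `Σ`-integer, and the only normal subgroup of the source is cut out by `⊤`.
[cite: MochizukiCombGC2007, Rmk 1.1.3 p.8] -/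
theorem isProSigmaCompletion_of_subsingleton (Sigma : Set ℕ) {Γ : Type*} [Group Γ] [Subsingleton Γ]
    {P : Type*} [Group P] [TopologicalSpace P] [Subsingleton P] (ι : Γ →* P) :
    IsProSigmaCompletion Sigma ι where
  dense := by
    have h : Set.range ι = Set.univ := Set.eq_univ_of_forall fun x => ⟨1, Subsingleton.elim _ _⟩
    rw [h]
    exact dense_univ
  index_open N _ _ := by
    have h1 : N.index = 1 := by rw [Subsingleton.elim N ⊤, Subgroup.index_top]
    rw [h1]
    exact ⟨Nat.one_pos, fun p hp hdvd => absurd (Nat.eq_one_of_dvd_one hdvd) hp.one_lt.ne'⟩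
  comap_surj N _ _ :=
    ⟨⊤, by rw [Subgroup.coe_top]; exact isOpen_univ, by rw [Subgroup.comap_top, Subsingleton.elim N ⊤]⟩

namespace PSCDatum

open scoped Pointwise

variable {P : Type u} [Group P] [TopologicalSpace P] [IsTopologicalGroup P]

section Shape

variable (G : PSCDatum P)

/-! ### Bookkeeping at smooth-proper shape -/

omit [IsTopologicalGroup P] in
/-- No nodes ⇒ every covering has `n = 0`. [cite: MochizukiCombGC2007, Def 1.1(i) p.6] -/
theorem nodeCount_eq_zero_of_isEmpty [IsEmpty G.graph.N] (U : Subgroup P) : G.nodeCount U = 0 := by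
  unfold nodeCount
  exact Finset.sum_eq_zero fun e _ => isEmptyElim e

omit [IsTopologicalGroup P] in
/-- One vertex with `Π_v = Π` ⇒ every covering has `i = 1` (`U \ Π / Π` is a point).
[cite: MochizukiCombGC2007, Def 1.1(i) p.6] -/
theorem vertCount_eq_one_of_smoothProper (hV : ∀ v, G.vertGp v = ⊤) (v₀ : G.graph.V)
    (hv : ∀ w, w = v₀) (U : Subgroup P) : G.vertCount U = 1 := by
  haveI : Unique G.graph.V := ⟨⟨v₀⟩, hv⟩
  unfold vertCount
  rw [Fintype.sum_unique, Subsingleton.elim (default : G.graph.V) v₀, hV, natCard_doubleCosetQuotient_top]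

/-- No cusps ⇒ `M^cusp_{G_U} = 0`: `cuspFil U = closure [U, U]`. [cite: MochizukiCombGC2007, Def 1.1(ii) p.7] -/
theorem cuspFil_eq_closure_commutator_of_isEmpty [IsEmpty G.graph.C] (U : Subgroup P) :
    G.cuspFil U = (⁅U, U⁆ : Subgroup P).topologicalClosure := by
  haveI : IsEmpty {A : Subgroup P // G.IsCuspidalIn U A} :=
    ⟨fun A => by obtain ⟨B, hB, -⟩ := A.2; exact G.not_isCuspidal_of_isEmpty B hB⟩
  unfold cuspFil
  rw [iSup_of_empty, sup_bot_eq]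

/-- No edges ⇒ `M^edge_{G_U} = 0`: `edgeFil U = closure [U, U]`. [cite: MochizukiCombGC2007, Def 1.1(ii) p.7] -/
theorem edgeFil_eq_closure_commutator_of_isEmpty [IsEmpty G.graph.N] [IsEmpty G.graph.C]
    (U : Subgroup P) : G.edgeFil U = (⁅U, U⁆ : Subgroup P).topologicalClosure := by
  haveI : IsEmpty {A : Subgroup P // G.IsEdgeLikeIn U A} :=
    ⟨fun A => by obtain ⟨B, hB, -⟩ := A.2; exact G.not_isEdgeLike_of_isEmpty B hB⟩
  unfold edgeFil
  rw [iSup_of_empty, sup_bot_eq]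

/-! ### The four rank statements at smooth-proper shape -/

/-- **[CombGC] Rmk. 1.1.3 at smooth-proper shape**: at every open level `U`, `M_{G_U} / M^vert_{G_U}` is
trivial (`vertFil U = U`) and `n(G_U) + 1 − i(G_U) = 0 + 1 − 1 = 0`, so it is the pro-`Σ` completion of
`ℤ^0`. [cite: MochizukiCombGC2007, Rmk 1.1.3 p.8] -/
theorem abelianizedGrphRank_of_smoothProper [IsEmpty G.graph.N] (hV : ∀ v, G.vertGp v = ⊤)
    (v₀ : G.graph.V) (hv : ∀ w, w = v₀) : G.AbelianizedGrphRank := by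
  intro U hU _
  have hk : G.nodeCount U + 1 - G.vertCount U = 0 := by
    rw [G.nodeCount_eq_zero_of_isEmpty, G.vertCount_eq_one_of_smoothProper hV v₀ hv]
  haveI : IsEmpty (Fin (G.nodeCount U + 1 - G.vertCount U)) := ⟨fun i => absurd i.2 (by omega)⟩
  have htop : (G.vertFil U).subgroupOf U = ⊤ := by
    rw [G.vertFil_eq_self_of_isOpen hV v₀ hU, Subgroup.subgroupOf_self]
  haveI : Subsingleton (U ⧸ (G.vertFil U).subgroupOf U) := by
    rw [htop]
    exact QuotientGroup.subsingleton_quotient_top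
  exact ⟨1, isProSigmaCompletion_of_subsingleton G.Sigma _⟩

/-- **[CombGC] Rmk. 1.3.1, first claim, at smooth-proper shape**: at every open level both
`M_{G_U} / M^vert_{G_U}` and `M^edge_{G_U} / M^cusp_{G_U}` are trivial — pro-`Σ` completions of the same
`ℤ^0`. [cite: MochizukiCombGC2007, Rmk 1.3.1 p.10] -/
theorem dualityRankEq_of_smoothProper [IsEmpty G.graph.N] [IsEmpty G.graph.C] (hV : ∀ v, G.vertGp v = ⊤)
    (v₀ : G.graph.V) : G.DualityRankEq := by
  intro _ U hU _ _
  have htop : (G.vertFil U).subgroupOf U = ⊤ := by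
    rw [G.vertFil_eq_self_of_isOpen hV v₀ hU, Subgroup.subgroupOf_self]
  haveI : Subsingleton (U ⧸ (G.vertFil U).subgroupOf U) := by
    rw [htop]
    exact QuotientGroup.subsingleton_quotient_top
  have htop' : (G.cuspFil U).subgroupOf (G.edgeFil U) = ⊤ := by
    rw [G.cuspFil_eq_closure_commutator_of_isEmpty, ← G.edgeFil_eq_closure_commutator_of_isEmpty,
      Subgroup.subgroupOf_self]
  haveI : Subsingleton (G.edgeFil U ⧸ (G.cuspFil U).subgroupOf (G.edgeFil U)) := by
    rw [htop']
    exact QuotientGroup.subsingleton_quotient_top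
  exact ⟨0, 1, 1, isProSigmaCompletion_of_subsingleton G.Sigma _,
    isProSigmaCompletion_of_subsingleton G.Sigma _⟩

/-- **[CombGC] Rmk. 1.3.1, second claim, with no cusps**: vacuous (`r(G_U) = 0` at every level).
[cite: MochizukiCombGC2007, Rmk 1.3.1 p.10] -/
theorem cuspRank_of_isEmpty [IsEmpty G.graph.C] : G.CuspRank := by
  intro U _ hr
  rw [G.cuspCount_eq_zero_of_isEmpty] at hr
  exact absurd hr (lt_irrefl 0)

/-- **[CombGC] Rmk. 1.3.1, third claim, with no cusps**: `G` is noncuspidal, and `M^cusp_{G_U} = 0` at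
every level — both sides of the iff hold. [cite: MochizukiCombGC2007, Rmk 1.3.1 p.10] -/
theorem noncuspidalIffCuspFilTrivial_of_isEmpty [IsEmpty G.graph.C] : G.NoncuspidalIffCuspFilTrivial := by
  refine iff_of_true ?_ fun U _ => G.cuspFil_eq_closure_commutator_of_isEmpty U
  change G.graph.r = 0
  exact Fintype.card_eq_zero

end Shape

/-! ### Over the origin -/

section Origin

variable (Ω : PSCOrigin.{u})

/-- **`RankStatementsHold Ω` at every origin of smooth-proper data** ([CombGC] Rmk. 1.1.3 / 1.3.1 at the
simplest geometric shape: every rank is `0`).  Hypothesis shape = that of abc-iut-L3-t4's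
`…Holds_of_smoothProper` family. [cite: MochizukiCombGC2007, Rmk 1.3.1 p.10] -/
theorem rankStatementsHold_of_smoothProper
    (hΩ : ∀ ⦃Q : Type u⦄ [Group Q] [TopologicalSpace Q] (G : PSCDatum Q), Ω.IsOfPSCType G →
      IsEmpty G.graph.N ∧ IsEmpty G.graph.C ∧ (∀ v, G.vertGp v = ⊤) ∧ ∃ v₀ : G.graph.V, ∀ w, w = v₀) :
    RankStatementsHold Ω := by
  intro Q _ _ _ G hG
  obtain ⟨hN, hC, hV, v₀, hv⟩ := hΩ G hG
  exact ⟨G.abelianizedGrphRank_of_smoothProper hV v₀ hv, G.dualityRankEq_of_smoothProper hV v₀,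
    G.cuspRank_of_isEmpty, G.noncuspidalIffCuspFilTrivial_of_isEmpty⟩

end Origin

end PSCDatum

end Literature.AnabelianGeometry.SemiGraphs
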